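import Literature.Geometry.Riemannian.HamiltonPICDecomposition
import HarnessLib

/-!
# Hamilton's Cor. 1.2(a) (`hamilton_pic_sphere_four`) from its two leaves:
# Chen–Zhu's surgery step and Cerf's theorem (fact decomposition, 2026-08-16)

Topic `Geometry/Riemannian`. The named fact `Literature.Geometry.Riemannian.hamilton_pic_sphere_four`
(`PICSphereFacts.lean`; Hamilton, Comm. Anal. Geom. 5 (1997), Cor. 1.2(a): a compact simply
connected four-manifold with a metric of positive isotropic curvature is diffeomorphic to `S⁴`;
surgery argument completed by Chen–Zhu, J. Differential Geom. 74 (2006)) is the same theorem as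
`hamilton_chen_tang_zhu` (`HamiltonPIC.lean`) in the encoding of the route `SmoothPoincare4/PIC`
(`hamilton_pic_sphere_four_iff_hamilton_chen_tang_zhu`, `PICSphereFactsProofs.lean`). Its
decomposition is therefore the one of `HamiltonPICDecomposition.lean` (fact decomposition of
`hamilton_chen_tang_zhu`, same day): the two leaves

* `chenZhu_surgicalStep_admissibleRestart` — Chen–Zhu 2006, §5: the surgery step at one singular
  time with admissible restart data (the analytic content of Thm. 5.6 beyond its base case and the
  finiteness count, both proved; verbatim the hypothesis of `chenZhu_ricciFlowWithSurgery_of_step`),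
* `Literature.Topology.FourManifolds.cerf_pi0DiffDisc_relBoundary_three` — Cerf 1968,
  `π₀ Diff(D³ rel ∂) = 0`,

with the glue PROVED in the tree: `chenZhu_ricciFlowWithSurgery_of_step`
(`SurgicalSolutionsCount.lean`: the count of p. 43 gives the structure statement of Thm. 1.1) and
`hamilton_pic_sphere_four_of_chenZhu_of_cerfRelBoundary` (`PICSphereFactsHolds.lean`: Thm. 1.1 and
`Γ₄ = 0` give Cor. 1.2(a) through the neck-surgery shadow of Hamilton's programme). This file
records the assemblies for this rendering and for the printed-list rendering
`hamilton_pic_classification_four` (`HamiltonPICClassification.lean`); the rendering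
`hamilton_chen_tang_zhu` is `hamilton_chen_tang_zhu_holds_of` of `HamiltonPICDecomposition.lean`.
So all three renderings of Hamilton's theorem close on the same two leaves. Theorems only; no
definition, no new named fact (the child is NOT restated here).

## References

* B.-L. Chen, X.-P. Zhu, *Ricci flow with surgery on four-manifolds with positive isotropic
  curvature*, J. Differential Geom. 74 (2006) 177–264, arXiv:math/0504478: Thm. 1.1 (p. 3), §5
  (Lemma 5.2, Lemma 5.3, Prop. 5.4, Lemma 5.5, Thm. 5.6, p. 43 "Summing up"). [ChenZhu2006]
* R. S. Hamilton, *Four-manifolds with positive isotropic curvature*, Comm. Anal. Geom. 5 (1997)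
  1–92, Thm. 1.1 (p. 2), Cor. 1.2(a) (p. 3). [Hamilton1997]
* J. Cerf, *Sur les difféomorphismes de la sphère de dimension trois (Γ₄ = 0)*, Lecture Notes in
  Mathematics 53, Springer 1968, Ch. I §§1–2. [CerfDiffeoSphere1968]
-/

noncomputable section

open scoped Manifold ContDiff Topology

namespace Literature.Geometry.Riemannian

open Lorentzian Literature.Topology.FourManifolds

/-- **Hamilton 1997, Cor. 1.2(a) (`hamilton_pic_sphere_four`) from its two leaves** — the
assembly of the decomposition: Chen–Zhu's surgery step with admissible restart data
(`chenZhu_surgicalStep_admissibleRestart`, turned into the structure statement of Thm. 1.1 by the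
proved count of surgeries `chenZhu_ricciFlowWithSurgery_of_step`) and Cerf's
`π₀ Diff(D³ rel ∂) = 0` (`cerf_pi0DiffDisc_relBoundary_three`), through
`hamilton_pic_sphere_four_of_chenZhu_of_cerfRelBoundary`. The discharge
`hamilton_pic_sphere_four_holds` is this theorem applied to the two `_holds` once they land.
[cite: Hamilton1997, Cor. 1.2(a) (p. 3)] [cite: ChenZhu2006, Thm. 1.1 (p. 3), Thm. 5.6 (p. 43)]
[cite: CerfDiffeoSphere1968, Ch. I §2] -/
theorem hamilton_pic_sphere_four_holds_of (hstep : chenZhu_surgicalStep_admissibleRestart)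
    (hcerf : cerf_pi0DiffDisc_relBoundary_three) : hamilton_pic_sphere_four :=
  hamilton_pic_sphere_four_of_chenZhu_of_cerfRelBoundary
    (chenZhu_ricciFlowWithSurgery_of_step hstep) hcerf

/-- **Hamilton 1997, Thm. 1.1 (simply connected case, printed list of pieces,
`hamilton_pic_classification_four`) from the same two leaves**
(`hamilton_pic_classification_four_of_chenZhu_of_cerfRelBoundary`).
[cite: Hamilton1997, Thm. 1.1 (p. 2)] [cite: ChenZhu2006, Thm. 5.6 (p. 43)] -/
theorem hamilton_pic_classification_four_holds_of
    (hstep : chenZhu_surgicalStep_admissibleRestart)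
    (hcerf : cerf_pi0DiffDisc_relBoundary_three) : hamilton_pic_classification_four :=
  hamilton_pic_classification_four_of_chenZhu_of_cerfRelBoundary
    (chenZhu_ricciFlowWithSurgery_of_step hstep) hcerf

end Literature.Geometry.Riemannian

end
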